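import Summits.Schanuel.Schanuel.Theorems.ZilberEacPoleFibreAsymptotics
import Summits.Schanuel.Schanuel.Theorems.ZilberEacGraphLinearTools
import HarnessLib

/-!
# Arbitrary base branches, LXXX(a): second-order asymptotics of the pole-fibre points — the unit
# factor to first and second order, polynomial growth of exact degree, the `ε` of file XXXI

HONEST FRAMING.  Cell `pub-schanuel` (Zilber's Exponential-Algebraic Closedness, case ladder;
host summit Schanuel), seat 2, gen 32.  Tools for file LXXX(b) (fast-regime pole fibres with an
arbitrary Puiseux tail): with `u_n^{-1} = exp(log(1 + ε_n)/k)`,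
* **`norm_exp_mul_log_one_add_sub_one_le`** — `‖(1+ε)^t − 1‖ ≤ 3t‖ε‖`,
* **`norm_exp_mul_log_one_add_sub_sub_le`** — `‖(1+ε)^t − 1 − tε‖ ≤ (3t² + t)‖ε‖²`
  (here `(1+ε)^t := exp(t·log(1+ε))`, `t ≥ 0` real, `‖ε‖ ≤ 1/2`, `(3/2)t‖ε‖ ≤ 1`);
* **`eventually_mul_pow_le_abs_eval`** — a nonzero real polynomial `g` has `c·x^{deg g} ≤ |g(x)|`
  for large `x`;
* **`poleFibre_eps_facts`** — the `ε_n` of file XXXI: `u_n^{-1} = exp(log(1+ε_n)/k)`,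
  `n·2πi·ε_n = −(L/k)log n + w_n`, `‖ε_n‖ ≤ ((|L|/k)log n + W)/(2πn) → 0`.
[folklore analysis]; nothing here is specific to Schanuel's conjecture (neither used nor implied);
Mantova–Masser's question (PLMS 2024 §1 p. 5) and EC(3,2) stay OPEN.
-/

noncomputable section

open Filter Topology Metric Complex Polynomial

set_option linter.dupNamespace false

namespace Summit.Schanuel.Schanuel.Theorems

/-! ## Part A. The unit factor to first and second order -/

/-- **First order**: `‖exp(t·log(1+ε)) − 1‖ ≤ 3t‖ε‖` for `t ≥ 0`, `‖ε‖ ≤ 1/2`, `(3/2)t‖ε‖ ≤ 1`.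
[folklore] -/
theorem norm_exp_mul_log_one_add_sub_one_le {ε : ℂ} {t : ℝ} (ht : 0 ≤ t) (hε : ‖ε‖ ≤ 1 / 2)
    (htε : 3 / 2 * t * ‖ε‖ ≤ 1) :
    ‖Complex.exp ((t : ℂ) * Complex.log (1 + ε)) - 1‖ ≤ 3 * t * ‖ε‖ := by
  have hlog : ‖Complex.log (1 + ε)‖ ≤ 3 / 2 * ‖ε‖ := Complex.norm_log_one_add_half_le_self hε
  have hy : ‖(t : ℂ) * Complex.log (1 + ε)‖ ≤ 3 / 2 * t * ‖ε‖ := by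
    rw [norm_mul, Complex.norm_real, Real.norm_eq_abs, abs_of_nonneg ht]
    nlinarith [norm_nonneg (Complex.log (1 + ε))]
  calc ‖Complex.exp ((t : ℂ) * Complex.log (1 + ε)) - 1‖ ≤ 2 * ‖(t : ℂ) * Complex.log (1 + ε)‖ :=
        Complex.norm_exp_sub_one_le (hy.trans htε)
    _ ≤ 3 * t * ‖ε‖ := by linarith

/-- **Second order**: `‖exp(t·log(1+ε)) − 1 − tε‖ ≤ (3t² + t)‖ε‖²` for `t ≥ 0`, `‖ε‖ ≤ 1/2`,
`(3/2)t‖ε‖ ≤ 1`. [folklore] -/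
theorem norm_exp_mul_log_one_add_sub_sub_le {ε : ℂ} {t : ℝ} (ht : 0 ≤ t) (hε : ‖ε‖ ≤ 1 / 2)
    (htε : 3 / 2 * t * ‖ε‖ ≤ 1) :
    ‖Complex.exp ((t : ℂ) * Complex.log (1 + ε)) - 1 - (t : ℂ) * ε‖ ≤ (3 * t ^ 2 + t) * ‖ε‖ ^ 2 := by
  have hε1 : ‖ε‖ < 1 := by linarith
  have hlog : ‖Complex.log (1 + ε)‖ ≤ 3 / 2 * ‖ε‖ := Complex.norm_log_one_add_half_le_self hε
  have hlog2 : ‖Complex.log (1 + ε) - ε‖ ≤ ‖ε‖ ^ 2 := by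
    have h := Complex.norm_log_one_add_sub_self_le hε1
    have h1 : (1 - ‖ε‖)⁻¹ ≤ 2 := by
      rw [inv_le_comm₀ (by linarith) two_pos]
      linarith
    calc ‖Complex.log (1 + ε) - ε‖ ≤ ‖ε‖ ^ 2 * (1 - ‖ε‖)⁻¹ / 2 := h
      _ ≤ ‖ε‖ ^ 2 * 2 / 2 := by gcongr
      _ = ‖ε‖ ^ 2 := by ring
  set y : ℂ := (t : ℂ) * Complex.log (1 + ε) with hydef
  have hy : ‖y‖ ≤ 3 / 2 * t * ‖ε‖ := by
    rw [hydef, norm_mul, Complex.norm_real, Real.norm_eq_abs, abs_of_nonneg ht]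
    nlinarith [norm_nonneg (Complex.log (1 + ε))]
  have hy1 : ‖y‖ ≤ 1 := hy.trans htε
  have h1 : ‖Complex.exp y - 1 - y‖ ≤ ‖y‖ ^ 2 := Complex.norm_exp_sub_one_sub_id_le hy1
  have h2 : ‖y - (t : ℂ) * ε‖ ≤ t * ‖ε‖ ^ 2 := by
    rw [hydef, ← mul_sub, norm_mul, Complex.norm_real, Real.norm_eq_abs, abs_of_nonneg ht]
    exact mul_le_mul_of_nonneg_left hlog2 ht
  have e : Complex.exp y - 1 - (t : ℂ) * ε = (Complex.exp y - 1 - y) + (y - (t : ℂ) * ε) := by ring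
  rw [e]
  refine (norm_add_le _ _).trans ?_
  have h3 : ‖y‖ ^ 2 ≤ (3 / 2 * t * ‖ε‖) ^ 2 := pow_le_pow_left₀ (norm_nonneg _) hy 2
  nlinarith [norm_nonneg ε, sq_nonneg ‖ε‖]

/-! ## Part B. Polynomial growth of the exact degree -/

/-- **A nonzero real polynomial grows like its degree**: `c·x^{deg g} ≤ |g(x)|` for large `x`, with
`c = |lc(g)|/2`. [folklore] -/
theorem eventually_mul_pow_le_abs_eval (g : ℝ[X]) (hg : g ≠ 0) :
    ∃ c : ℝ, 0 < c ∧ ∀ᶠ x : ℝ in atTop, c * x ^ g.natDegree ≤ |g.eval x| := by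
  have hlc : 0 < |g.leadingCoeff| := abs_pos.2 (Polynomial.leadingCoeff_ne_zero.2 hg)
  refine ⟨|g.leadingCoeff| / 2, by positivity, ?_⟩
  have h := (Polynomial.isEquivalent_atTop_lead (P := g)).isLittleO.def (by norm_num : (0 : ℝ) < 1 / 2)
  filter_upwards [h, eventually_ge_atTop (0 : ℝ)] with x hx hx0
  simp only [Pi.sub_apply, Real.norm_eq_abs] at hx
  have hv : |g.leadingCoeff * x ^ g.natDegree| = |g.leadingCoeff| * x ^ g.natDegree := by
    rw [abs_mul, abs_of_nonneg (show (0 : ℝ) ≤ x ^ g.natDegree by positivity)]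
  rw [hv] at hx
  have htri := abs_sub_abs_le_abs_sub (g.leadingCoeff * x ^ g.natDegree) (eval x g)
  rw [abs_sub_comm, hv] at htri
  linarith

/-! ## Part C. The `ε` of the pole-fibre points -/

/-- **The `ε_n` of file XXXI.**  With `u_n = exp(−log(1 + ε_n)/k)`,
`ε_n = (−(L/k)log n + w_n)/(n·2πi)`: `u_n^{-1} = exp(log(1+ε_n)/k)`, `n·2πi·ε_n = −(L/k)log n + w_n`,
`‖ε_n‖ ≤ ((|L|/k)log n + W)/(2πn)`, and `‖ε_n‖ → 0`. [folklore] -/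
theorem poleFibre_eps_facts {k : ℕ} (L : ℤ) {N₀ : ℕ} (hN₀ : 1 ≤ N₀)
    {u w : ℕ → ℂ} {W : ℝ} (hw : ∀ j, ‖w j‖ ≤ W)
    (hu : ∀ j, u j = Complex.exp (-(Complex.log (1 + ((-(L : ℂ) / k) *
      (Real.log ((N₀ + j : ℕ) : ℝ) : ℂ) + w j) / (((N₀ + j : ℕ) : ℂ) * (2 * Real.pi * I)))) / k)) :
    ∃ ε : ℕ → ℂ, (∀ j, (u j)⁻¹ = Complex.exp (Complex.log (1 + ε j) / k)) ∧
      (∀ j, ((N₀ + j : ℕ) : ℂ) * (2 * Real.pi * I) * ε j =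
        (-(L : ℂ) / k) * (Real.log ((N₀ + j : ℕ) : ℝ) : ℂ) + w j) ∧
      (∀ j, ‖ε j‖ ≤ ((|(L : ℝ)| / k) * Real.log ((N₀ + j : ℕ) : ℝ) + W) /
        (2 * Real.pi * ((N₀ + j : ℕ) : ℝ))) ∧
      Tendsto (fun j => ‖ε j‖) atTop (𝓝 0) := by
  set ℓ : ℕ → ℝ := fun j => Real.log ((N₀ + j : ℕ) : ℝ) with hℓ
  set ε : ℕ → ℂ := fun j => ((-(L : ℂ) / k) * (ℓ j : ℂ) + w j) /
    (((N₀ + j : ℕ) : ℂ) * (2 * Real.pi * I)) with hε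
  have h2πI : (2 * Real.pi * I : ℂ) ≠ 0 := by simp [Real.pi_ne_zero, Complex.I_ne_zero]
  have hn1 : ∀ j, (1 : ℝ) ≤ ((N₀ + j : ℕ) : ℝ) := fun j => by
    exact_mod_cast (show 1 ≤ N₀ + j by omega)
  have hnC : ∀ j, ((N₀ + j : ℕ) : ℂ) ≠ 0 := fun j => by
    exact_mod_cast (show (N₀ + j : ℕ) ≠ 0 by omega)
  have hℓ0 : ∀ j, 0 ≤ ℓ j := fun j => Real.log_nonneg (hn1 j)
  have hεle : ∀ j, ‖ε j‖ ≤ ((|(L : ℝ)| / k) * ℓ j + W) / (2 * Real.pi * ((N₀ + j : ℕ) : ℝ)) := by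
    intro j
    rw [hε, norm_div, norm_mul, Complex.norm_natCast]
    have hden : ‖(2 * Real.pi * I : ℂ)‖ = 2 * Real.pi := by
      rw [norm_mul, Complex.norm_I, mul_one, Complex.norm_mul, Complex.norm_real,
        Complex.norm_ofNat, Real.norm_eq_abs, abs_of_pos Real.pi_pos]
    rw [hden]
    have hnum : ‖(-(L : ℂ) / k) * (ℓ j : ℂ) + w j‖ ≤ (|(L : ℝ)| / k) * ℓ j + W := by
      refine (norm_add_le _ _).trans (add_le_add ?_ (hw j))
      rw [norm_mul, norm_div, norm_neg, Complex.norm_intCast, Complex.norm_natCast,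
        Complex.norm_real, Real.norm_eq_abs, abs_of_nonneg (hℓ0 j)]
    rw [mul_comm (((N₀ + j : ℕ) : ℝ)) (2 * Real.pi)]
    exact div_le_div_of_nonneg_right hnum (by positivity)
  refine ⟨ε, fun j => ?_, fun j => ?_, hεle, ?_⟩
  · rw [hu j, neg_div, Complex.exp_neg, inv_inv]
  · have h1 := hnC j
    simp only [hε, hℓ]
    field_simp
  · have h := (tendsto_log_label_div (|(L : ℝ)| / k) W).comp (tendsto_add_atTop_nat N₀)
    refine squeeze_zero (fun j => norm_nonneg _) hεle (h.congr fun j => ?_)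
    simp only [Function.comp_apply, hℓ]
    rw [show j + N₀ = N₀ + j from Nat.add_comm _ _]

/-- **Powers of the unit factor**: `(u_n^{-1})^j = exp((j/k)·log(1+ε_n))`. [folklore] -/
theorem inv_pow_eq_exp_mul_log {u ε : ℂ} {k : ℕ} (hk : 1 ≤ k)
    (hu : u⁻¹ = Complex.exp (Complex.log (1 + ε) / k)) (j : ℕ) :
    u⁻¹ ^ j = Complex.exp ((((j : ℝ) / k : ℝ) : ℂ) * Complex.log (1 + ε)) := by
  rw [hu, ← Complex.exp_nat_mul]
  congr 1
  have hk0 : (k : ℂ) ≠ 0 := by exact_mod_cast (show k ≠ 0 by omega)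
  push_cast
  field_simp

end Summit.Schanuel.Schanuel.Theorems

end
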